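import Summits.ABC.IUTFork.Conditional.AbcOfSHvolSplitHeight
import Summits.ABC.IUTFork.LDHLocalProofData
import HarnessLib

/-!
# Branch C, the CONE binder `hreg` (v4 `abc_of_S_v4` / v6K / v10M line of record): at a point of the `λ`-line with a MIXED prime,
# EVERY genuine Θ-volume datum is non-slot-constant, so `hreg` gives the full (ii′-U) there — and the datum-free split-pair inequality

Proof-only file (0 definitions, no new `Prop`) of the abc-iut cell (R2 S-chain seat abc-iut-s2-p5, TARGET #1 «hvol residue»), sequel to
`Conditional/AbcOfSHvolSplitHeight.lean` (p435094: `hvol ⟹` the split-pair abc/Szpiro-type inequality on `j(λ)`, datum-free). Since v4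
(`Conditional/AbcOfSGenuineRegime.lean`, C-lead C-R13) the line-of-record certificates carry the WEAKER cone binder `hreg` = abc-iut-c312-8's
`stub_hullRegime` body: the hull estimate with print's `B_III(P,l)` only at data `T` that are NOT slot-constant
(`¬ ∀ p ∈ T(I), ∀ v w | p, logQloc p v = logQloc p w`). THIS FILE shows that the necessity certificate of p435094 applies to `hreg` verbatim:

* `PointDict.not_slotConstant_of_splitPair` — if `F_mod = ℚ(j(λ))` has places `v, w` over one rational prime `p` with `ord_v j(λ) < 0`,
  `v ∤ 2l` and (`ord_w j(λ) ≥ 0` ∨ `w | 2` ∨ `w | l`), then EVERY genuine Θ-volume datum `T` at `(P, l)` is non-slot-constant: transported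
  into the datum's `F_mod(E_F)` (same image in `F`, `range_algebraMap_adjoin_jInv_eq`), `v` becomes a (P5)-bad prime `v'` (`T.isP5Choice`)
  with `logQloc p v' = ord_{v'}(q)·ln N(v')/n_{v'} > 0` and `w` a non-bad prime `w'` with `logQloc p w' = 0`;
* `PointDict.hullVolumeAtDatum_BIII_of_hreg` — hence `hreg` (v4's binder VERBATIM) gives `Cor22.HullVolumeAtDatum P l (B_III P l)` at every
  admissible `(P, l)` whose `F_mod` has such a pair — off the «equal-heights locus» the binders `hreg` and `hvol` AGREE;
* **`PointDict.splitPair_le_BIII_of_hreg`** — `hreg ⟹ Pr(v)·Pr(w)·((l+1)/24)·(−ord_v j(λ))·log N(v)/n_v ≤ B_III(P,l)` at every admissible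
  `(P, l)` and every such pair: the refute-direction certificate of p435094 for the CURRENT cone binder.

Nothing asserted about any point or about [IUTchIII] Cor. 3.12 / [IUTchIV] Thm. 1.10; typed ≠ proved.
[cite: Mochizuki2012, IUTchIV Thm. 1.10 Step (v) p. 27–28] [cite: Mochizuki2012, IUTchIV Cor. 2.2 (ii) proof p. 46]
[cite: DupuyHilado2025, §3.3, §3.6, §4.7, §4.12] [claim: Mochizuki2012, status: disputed]
-/

noncomputable section

namespace Summit.ABC.IUTFork

open NumberField IsDedekindDomain Literature.IUT.LogVolume Literature.IUT.HodgeTheaters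
open Literature.NumberTheory.DiophantineGeometry.GenEll
open scoped Classical

namespace PointDict

variable {P : NFPoint} {l : ℕ}

/-- **A mixed pair of places of `ℚ(j(λ))` makes EVERY genuine Θ-volume datum at `(P, l)` non-slot-constant** (`logQloc p v' > 0 = logQloc p w'`
at the transported bad / non-bad primes `v', w'` of the datum's `F_mod(E_F)`). [cite: Mochizuki2012, IUTchIV Cor. 2.2 (ii) proof p. 46]
[cite: DupuyHilado2025, §3.3] [claim: Mochizuki2012, status: disputed] -/
theorem not_slotConstant_of_splitPair (T : Cor22.ThetaVolumeDatumAt P l) (p : ℕ) [Fact p.Prime]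
    (v w : HeightOneSpectrum (𝓞 ↥(IntermediateField.adjoin ℚ ({Cor22.jInv P.x} : Set P.F))))
    (hv : v ∈ placesOver _ p) (hw : w ∈ placesOver _ p) (hvj : ord _ v (Cor22.jMod P) < 0)
    (hv2 : ((2 : ℕ) : 𝓞 _) ∉ v.asIdeal) (hvl : ((l : ℕ) : 𝓞 _) ∉ v.asIdeal)
    (hwj : 0 ≤ ord _ w (Cor22.jMod P) ∨ ((2 : ℕ) : 𝓞 _) ∈ w.asIdeal ∨ ((l : ℕ) : 𝓞 _) ∈ w.asIdeal) :
    (letI := T.instFieldF; letI := T.instNumberFieldF; letI := T.instAlgebraF; letI := T.instFieldK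
     letI := T.instNumberFieldK; letI := T.instAlgebraK; letI := T.instFieldFbar; letI := T.instAlgebraFbar
     letI := T.instAlgebraKFbar; letI := T.instIsElliptic
     ¬ (∀ p ∈ T.I.supportPrimes, ∀ v w : placesOver (fieldOfModuli T.E) p,
        (Summit.ABC.IUTFork.DHData.ofInput T.I).logQloc p v = (Summit.ABC.IUTFork.DHData.ofInput T.I).logQloc p w)) := by
  letI := T.instFieldF; letI := T.instNumberFieldF; letI := T.instAlgebraF; letI := T.instFieldK
  letI := T.instNumberFieldK; letI := T.instAlgebraK; letI := T.instFieldFbar; letI := T.instAlgebraFbar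
  letI := T.instAlgebraKFbar; letI := T.instIsElliptic
  -- the two copies of `F_mod` inside `F` (as in `splitPair_le_of_hullVolumeAtDatum`)
  set Fm : Type := ↥(IntermediateField.adjoin ℚ ({Cor22.jInv P.x} : Set P.F)) with hFm
  letI : Algebra Fm T.F := ((algebraMap P.F T.F).comp (algebraMap Fm P.F)).toAlgebra
  have hjj : algebraMap Fm T.F (Cor22.jMod P) = algebraMap ↥(fieldOfModuli T.E) T.F (ThetaData.jMod T.E) := by
    change algebraMap P.F T.F (algebraMap Fm P.F (Cor22.jMod P)) = T.E.j
    rw [T.j_eq]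
    rfl
  obtain ⟨x, hx⟩ := PlaceSection.exists_under_eq (F₀ := Fm) (K := T.F) v
  obtain ⟨y, hy⟩ := PlaceSection.exists_under_eq (F₀ := Fm) (K := T.F) w
  have hxv : finBelow Fm T.F x = v := HeightOneSpectrum.ext (by rw [← hx]; rfl)
  have hyw : finBelow Fm T.F y = w := HeightOneSpectrum.ext (by rw [← hy]; rfl)
  have hxp : x ∈ placesOver T.F p := by
    rw [mem_placesOver_iff_residueChar] at hv ⊢
    rw [← residueChar_finBelow (F := Fm), hxv, hv]
  have hyp : y ∈ placesOver T.F p := by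
    rw [mem_placesOver_iff_residueChar] at hw ⊢
    rw [← residueChar_finBelow (F := Fm), hyw, hw]
  set v' := finBelow ↥(fieldOfModuli T.E) T.F x with hv'
  set w' := finBelow ↥(fieldOfModuli T.E) T.F y with hw'
  have hv'p : v' ∈ placesOver ↥(fieldOfModuli T.E) p := finBelow_mem_placesOver _ T.F hxp
  have hw'p : w' ∈ placesOver ↥(fieldOfModuli T.E) p := finBelow_mem_placesOver _ T.F hyp
  -- `v'` is (P5)-bad
  have hordx : ord T.F x T.E.j < 0 := by
    have h1 : ord Fm (finBelow Fm T.F x) (Cor22.jMod P) < 0 := by rw [hxv]; exact hvj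
    rw [← Cor22.ord_algebraMap_neg_iff x (Cor22.jMod P), hjj] at h1
    exact h1
  have hmult : T.E.HasMultiplicativeReductionAt x := by
    refine (T.D.isSemistable x).resolve_left fun hgood => ?_
    have hle : x.valuation T.F T.E.j ≤ 1 := valuation_j_le_one_of_hasGoodReduction_localMinimalModel x T.E hgood
    have h0 : 0 ≤ ord T.F x T.E.j := by
      unfold ord
      rw [neg_nonneg]
      by_cases hz : x.valuation T.F T.E.j = 0
      · simp [hz]
      · rw [← WithZero.log_one]
        exact (WithZero.log_le_log hz one_ne_zero).mpr hle
    omega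
  have hx2l : ∀ q ∈ ({2, l} : Finset ℕ), ((q : ℕ) : 𝓞 T.F) ∉ x.asIdeal := by
    intro q hq hmem
    have hmem' : ((q : ℕ) : 𝓞 Fm) ∈ (finBelow Fm T.F x).asIdeal :=
      (Cor22.natCast_mem_asIdeal_finBelow_iff x q).mpr hmem
    rw [hxv] at hmem'
    simp only [Finset.mem_insert, Finset.mem_singleton] at hq
    rcases hq with rfl | rfl
    · exact hv2 hmem'
    · exact hvl hmem'
  have hv'bad : v' ∈ ThetaData.badPrimesMod T.D := by
    have hVF : FinitePlace.mk x ∈ T.D.VFbad :=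
      (T.isP5Choice (FinitePlace.mk x)).mpr (by rw [FinitePlace.maximalIdeal_mk]; exact ⟨hx2l, hmult⟩)
    have h1 := (ThetaData.mk_mem_VFbad_iff T.D x).mp hVF
    have he : HeightOneSpectrum.under (𝓞 ↥(fieldOfModuli T.E)) x = v' := HeightOneSpectrum.ext rfl
    rwa [he] at h1
  -- `w'` is NOT bad
  have hw'not : w' ∉ ThetaData.badPrimesMod T.D := by
    intro hbad
    have he : HeightOneSpectrum.under (𝓞 ↥(fieldOfModuli T.E)) y = w' := HeightOneSpectrum.ext rfl
    have hVF : FinitePlace.mk y ∈ T.D.VFbad := (ThetaData.mk_mem_VFbad_iff T.D y).mpr (by rw [he]; exact hbad)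
    obtain ⟨hy2l, hmulty⟩ := (T.isP5Choice (FinitePlace.mk y)).mp hVF
    rw [FinitePlace.maximalIdeal_mk] at hy2l hmulty
    have hordy : ord T.F y T.E.j < 0 := ThetaData.ord_j_neg_of_hasMultiplicativeReductionAt hmulty
    rcases hwj with hge | h2 | hl2
    · have h1 : ord Fm (finBelow Fm T.F y) (Cor22.jMod P) < 0 := by
        rw [← Cor22.ord_algebraMap_neg_iff y (Cor22.jMod P), hjj]
        exact hordy
      rw [hyw] at h1
      exact absurd h1 (not_lt.mpr hge)
    · exact hy2l 2 (by simp) ((Cor22.natCast_mem_asIdeal_finBelow_iff y 2).mp (by rw [hyw]; exact h2))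
    · exact hy2l l (by simp) ((Cor22.natCast_mem_asIdeal_finBelow_iff y l).mp (by rw [hyw]; exact hl2))
  -- the slot values differ: `logQloc p v' > 0 = logQloc p w'`
  have hS : (DHData.ofInput T.I).X.S = ThetaData.badPrimesMod T.D := by
    rw [DHData.ofInput_X, T.isVolumeInputOf.X_eq]; rfl
  have hw'0 : (DHData.ofInput T.I).logQloc p ⟨w', hw'p⟩ = 0 := by
    unfold DHData.logQloc
    rw [DHData.qDivisor_apply_eq_zero_of_not_mem _ (by rw [hS]; exact hw'not), zero_mul, zero_div]
  have hv'pos : 0 < (DHData.ofInput T.I).logQloc p ⟨v', hv'p⟩ := by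
    unfold DHData.logQloc
    have hmem : v' ∈ (DHData.ofInput T.I).X.S := by rw [hS]; exact hv'bad
    have hq : (DHData.ofInput T.I).X.qDivisor v' = ((DHData.ofInput T.I).X.ordq v' : ℝ) := by
      show (∑ u ∈ (DHData.ofInput T.I).X.S, FinDivisor.of u ((DHData.ofInput T.I).X.ordq u : ℝ)) v' = _
      rw [Finsupp.finsetSum_apply, Finset.sum_eq_single v']
      · rw [FinDivisor.of, Finsupp.single_apply, if_pos rfl]
      · intro u _ huv
        rw [FinDivisor.of, Finsupp.single_apply, if_neg huv]
      · intro h; exact absurd hmem h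
    rw [hq]
    have h1 : (0 : ℝ) < ((DHData.ofInput T.I).X.ordq v' : ℝ) := by exact_mod_cast (DHData.ofInput T.I).X.ordq_pos hmem
    have h2 := logNorm_pos ↥(fieldOfModuli T.E) v'
    have h3 : (0 : ℝ) < (localDegree ↥(fieldOfModuli T.E) v' : ℝ) := by exact_mod_cast localDegree_pos _ v'
    positivity
  have hpT : p ∈ T.I.supportPrimes := by
    have h1 := residueChar_mem_supportPrimes_of_bad T v' hv'bad
    rwa [(mem_placesOver_iff_residueChar v').mp hv'p] at h1
  intro hall
  have := hall p hpT ⟨v', hv'p⟩ ⟨w', hw'p⟩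
  rw [hw'0] at this
  exact absurd this hv'pos.ne'

/-- **`hreg` (v4's cone binder, VERBATIM) gives the full (ii′-U) `Cor22.HullVolumeAtDatum P l (B_III P l)` at every admissible `(P, l)` whose
`F_mod = ℚ(j(λ))` has a mixed pair over some rational prime** — there every datum is non-slot-constant. [cite: Mochizuki2012, IUTchIV Thm. 1.10 Step (v) p. 27–28]
[claim: Mochizuki2012, status: disputed] -/
theorem hullVolumeAtDatum_BIII_of_hreg
    (hreg : ∀ P : NFPoint, P ∈ UP → ∀ l : ℕ, l.Prime → 5 ≤ l →
      Cor22.AdmitsCore P → Cor22.CondP2 P l → Cor22.CondP5 P l → Cor22.CondP6 P l →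
      ∀ T : Cor22.ThetaVolumeDatumAt P l,
        (letI := T.instFieldF; letI := T.instNumberFieldF; letI := T.instAlgebraF; letI := T.instFieldK
         letI := T.instNumberFieldK; letI := T.instAlgebraK; letI := T.instFieldFbar; letI := T.instAlgebraFbar
         letI := T.instAlgebraKFbar; letI := T.instIsElliptic
         ¬ (∀ p ∈ T.I.supportPrimes, ∀ v w : placesOver (fieldOfModuli T.E) p,
            (Summit.ABC.IUTFork.DHData.ofInput T.I).logQloc p v = (Summit.ABC.IUTFork.DHData.ofInput T.I).logQloc p w)) →
        T.HullEstimateOf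
          (((l : ℝ) + 1) / 4 *
            ((1 + 12 * (Cor22.dmod P : ℝ) / l) * (P.logDiff + Cor22.logCondAvoid P {2, l})
              + 2 * Real.log l + 52
              + 20 / 3 * Real.log (((2 ^ 12 * 3 ^ 3 * 5 * Cor22.dmod P : ℕ) : ℝ) * (l : ℝ))
                * (Nat.primeCounting (2 ^ 12 * 3 ^ 3 * 5 * Cor22.dmod P * l) : ℝ))))
    (hP : P ∈ UP) (hl : l.Prime) (h5 : 5 ≤ l) (hc : Cor22.AdmitsCore P) (hP2 : Cor22.CondP2 P l)
    (hP5 : Cor22.CondP5 P l) (hP6 : Cor22.CondP6 P l) (p : ℕ) [Fact p.Prime]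
    (v w : HeightOneSpectrum (𝓞 ↥(IntermediateField.adjoin ℚ ({Cor22.jInv P.x} : Set P.F))))
    (hv : v ∈ placesOver _ p) (hw : w ∈ placesOver _ p) (hvj : ord _ v (Cor22.jMod P) < 0)
    (hv2 : ((2 : ℕ) : 𝓞 _) ∉ v.asIdeal) (hvl : ((l : ℕ) : 𝓞 _) ∉ v.asIdeal)
    (hwj : 0 ≤ ord _ w (Cor22.jMod P) ∨ ((2 : ℕ) : 𝓞 _) ∈ w.asIdeal ∨ ((l : ℕ) : 𝓞 _) ∈ w.asIdeal) :
    Cor22.HullVolumeAtDatum P l (((l : ℝ) + 1) / 4 *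
      ((1 + 12 * (Cor22.dmod P : ℝ) / l) * (P.logDiff + Cor22.logCondAvoid P {2, l})
        + 2 * Real.log l + 52
        + 20 / 3 * Real.log (((2 ^ 12 * 3 ^ 3 * 5 * Cor22.dmod P : ℕ) : ℝ) * (l : ℝ))
          * (Nat.primeCounting (2 ^ 12 * 3 ^ 3 * 5 * Cor22.dmod P * l) : ℝ))) :=
  fun T => hreg P hP l hl h5 hc hP2 hP5 hP6 T (not_slotConstant_of_splitPair T p v w hv hw hvj hv2 hvl hwj)

/-- **THE CONE BINDER `hreg` OF THE LINE OF RECORD IMPLIES THE SAME EFFECTIVE abc/SZPIRO-TYPE INEQUALITY AS `hvol`** (p435094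
`splitPair_le_BIII_of_hvol`, now from the weaker binder): for every admissible `(λ, l)`, every rational prime `p` and places `v, w` of
`F_mod = ℚ(j(λ))` over `p` with `ord_v j(λ) < 0`, `v ∤ 2`, `v ∤ l` and (`ord_w j(λ) ≥ 0` or `w | 2` or `w | l`):
`Pr(v)·Pr(w)·((l+1)/24)·(−ord_v j(λ))·log N(v)/n_v ≤ B_III(λ, l)`. Datum by `ThetaPartII.stub_thetaData`; nothing else assumed. READING
(nothing asserted about any point): off the «equal-heights locus» the cone binders `hvol` (v3) and `hreg` (v4/v6K/v10M) coincide at `(P,l)`,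
and each CONTAINS this Diophantine inequality; a kernel refutation of `hreg` must exhibit an admissible `λ` violating it.
[cite: Mochizuki2012, IUTchIV Thm. 1.10 Step (v) p. 27–28] [cite: DupuyHilado2025, §3.3, §3.6, §4.7, §4.12] [claim: Mochizuki2012, status: disputed] -/
theorem splitPair_le_BIII_of_hreg
    (hreg : ∀ P : NFPoint, P ∈ UP → ∀ l : ℕ, l.Prime → 5 ≤ l →
      Cor22.AdmitsCore P → Cor22.CondP2 P l → Cor22.CondP5 P l → Cor22.CondP6 P l →
      ∀ T : Cor22.ThetaVolumeDatumAt P l,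
        (letI := T.instFieldF; letI := T.instNumberFieldF; letI := T.instAlgebraF; letI := T.instFieldK
         letI := T.instNumberFieldK; letI := T.instAlgebraK; letI := T.instFieldFbar; letI := T.instAlgebraFbar
         letI := T.instAlgebraKFbar; letI := T.instIsElliptic
         ¬ (∀ p ∈ T.I.supportPrimes, ∀ v w : placesOver (fieldOfModuli T.E) p,
            (Summit.ABC.IUTFork.DHData.ofInput T.I).logQloc p v = (Summit.ABC.IUTFork.DHData.ofInput T.I).logQloc p w)) →
        T.HullEstimateOf
          (((l : ℝ) + 1) / 4 *
            ((1 + 12 * (Cor22.dmod P : ℝ) / l) * (P.logDiff + Cor22.logCondAvoid P {2, l})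
              + 2 * Real.log l + 52
              + 20 / 3 * Real.log (((2 ^ 12 * 3 ^ 3 * 5 * Cor22.dmod P : ℕ) : ℝ) * (l : ℝ))
                * (Nat.primeCounting (2 ^ 12 * 3 ^ 3 * 5 * Cor22.dmod P * l) : ℝ))))
    (hP : P ∈ UP) (hl : l.Prime) (h5 : 5 ≤ l) (hc : Cor22.AdmitsCore P) (hP2 : Cor22.CondP2 P l)
    (hP5 : Cor22.CondP5 P l) (hP6 : Cor22.CondP6 P l) (p : ℕ) [Fact p.Prime]
    (v w : HeightOneSpectrum (𝓞 ↥(IntermediateField.adjoin ℚ ({Cor22.jInv P.x} : Set P.F))))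
    (hv : v ∈ placesOver _ p) (hw : w ∈ placesOver _ p) (hvj : ord _ v (Cor22.jMod P) < 0)
    (hv2 : ((2 : ℕ) : 𝓞 _) ∉ v.asIdeal) (hvl : ((l : ℕ) : 𝓞 _) ∉ v.asIdeal)
    (hwj : 0 ≤ ord _ w (Cor22.jMod P) ∨ ((2 : ℕ) : 𝓞 _) ∈ w.asIdeal ∨ ((l : ℕ) : 𝓞 _) ∈ w.asIdeal) :
    weight _ v * weight _ w * (((l : ℝ) + 1) / 24) *
        (((-ord _ v (Cor22.jMod P) : ℤ) : ℝ) * logNorm _ v / (localDegree _ v : ℝ)) ≤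
      ((l : ℝ) + 1) / 4 *
        ((1 + 12 * (Cor22.dmod P : ℝ) / l) * (P.logDiff + Cor22.logCondAvoid P {2, l})
          + 2 * Real.log l + 52
          + 20 / 3 * Real.log (((2 ^ 12 * 3 ^ 3 * 5 * Cor22.dmod P : ℕ) : ℝ) * (l : ℝ))
            * (Nat.primeCounting (2 ^ 12 * 3 ^ 3 * 5 * Cor22.dmod P * l) : ℝ)) := by
  obtain ⟨T⟩ := Summit.ABC.ABC.Theorems.ThetaPartII.stub_thetaData P hP l hl h5 hc hP2 hP5 hP6
  have h := splitPair_le_of_hullVolumeAtDatum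
    (hullVolumeAtDatum_BIII_of_hreg hreg hP hl h5 hc hP2 hP5 hP6 p v w hv hw hvj hv2 hvl hwj) T p v w hv hw hvj hv2 hvl hwj
  have hl0 : (l : ℝ) ≠ 0 := by exact_mod_cast hl.ne_zero
  have key : (l : ℝ) * ((l : ℝ) + 1) / 12 * (1 / (2 * (l : ℝ))) = ((l : ℝ) + 1) / 24 := by
    field_simp
    ring
  refine le_trans (le_of_eq ?_) h
  rw [← key]
  ring

end PointDict

end Summit.ABC.IUTFork

end
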